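import Literature.AlgebraicGeometry.Motives.GrassmannianSheaf
import Literature.AlgebraicGeometry.Motives.GrassmannianChartLocus
import Literature.AlgebraicGeometry.Motives.PointwiseOpenCondition
import Literature.AlgebraicGeometry.Motives.ZariskiSheafMorphismsOnAffines
import HarnessLib

/-!
# The standard charts of the Grassmannian sheaf as open-condition subfunctors

Topic `AlgebraicGeometry/Motives`; namespace `Literature.AlgebraicGeometry.Motives.Grassmannian`.
DEFINITIONS `ptEval`, `chartSubsheaf`, `chartLocus` + theorems; no instance, no notation, no named fact,
no `sorry`.  (h4) bricks (A3.4)–(A3.5) of the interface memo `A34-INTERFACE` (B-p21 (g15)):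

For a frame `x : Fin k → M` and the Grassmannian sheaf `Gr := (grassmannianSheaf M k).obj` on `Scheme.{u}`
(B-p21 (D3)), a section `y ∈ Gr(T)` lies in the **chart subfunctor** `chartSubsheaf M k x` iff at every point
`t ∈ T` its value `ptEval t y ∈ G(k, κ(t) ⊗ M; κ(t))` (restriction along `Spec κ(t) → T`, read through
`specEquiv`) lies in the ring-side chart `chart ℤ M k x κ(t)` of B-p18 (C1) — the POINTWISE definition, which is
visibly a subfunctor and satisfies the hypotheses (pt)/(refl) of `PointwiseOpenCondition`.  Results:

* `ptEval_map` — naturality of the point values along `h : T′ → T` (`κ(h t′) → κ(t′)`).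
* `chartSubsheaf` — the subfunctor; `map_fromSpecResidueField_mem_chartSubsheaf_iff` — the fibre condition.
* `map_Γevaluation_mem_chart_iff`, `isOpen_setOf_map_Γevaluation_mem_chart` — for ANY scheme `S` and
  `N ∈ G(k, Γ(S,⊤) ⊗ M)`, «`N ⊗ κ(q)` in the chart» iff `q ∈ S.basicOpen a` for some `a ∈ Ann(coker frameMap)`
  (B-p18 C3-inst `map_mem_chart_iff_ker_notMem_support`), an open condition.
* `ptEval_eq_map_evalAffine_top` — on an affine scheme the point values are the residue images of
  `evalAffine ⊤` (`fromSpecResidueField q = Spec (Γevaluation q) ≫ isoSpec.inv`).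
* **`chartLocus M k x y : T.Opens`** — the open locus `{t | ptEval t y ∈ chart}` (openness: local on `T` by
  `isOpen_setOf_pointwise_of_openCover`, affine case by the previous two items); `mem_chartLocus_iff`.
* **`map_mem_chartSubsheaf_iff`** — THE OPEN CONDITION:
  `Gr.map h.op y ∈ chartSubsheaf(T′) ↔ h(T′) ⊆ chartLocus y` (= `openCondition_of_pointwise`; (refl) is B-p18's
  `map_mem_chart_iff_of_field`).
* `isSheaf_chartSubsheaf` — the chart subfunctor is a Zariski sheaf (`isSheaf_toFunctor_of_openCondition`).
* `mem_chartSubsheaf_iff_evalAffine_top` — on an affine scheme `S`: `z ∈ chartSubsheaf(S) ↔ evalAffine ⊤ z ∈ chart`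
  (so, with (C4), `yoneda (chart scheme) → chartSubsheaf` is bijective on affines; then
  `isIso_of_bijective_app_Spec`).
* `mem_chartSubsheaf_Spec_iff` (`↔ specEquiv A y ∈ chart`), `mem_chartSubsheaf_iff_evalAffine` (`↔` all affine-open
  evaluations `evalAffine V y` lie in the chart) — the affine descriptions of the interface memo.
* `exists_mem_chartSubsheaf_of_field` — every field-valued point lies in the chart of some sub-frame of a
  generating family ((C5)); the `hcover` input of `isRepresentable_of_openCondition_cover`.

References: [GortzWedhorn2020] (8.4) (pp. 213–215), Lemma 8.13 (p. 215) (the open subfunctors `G^I` of the Grassmannian);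
[StacksProject, Tag 089T].  Cell `hodgecm-mathlib`, F-DAG first hand (h4); count-neutral capital.  HC_CM is proved only
modulo the 7 printed citations until rung 0 closes.
-/

namespace Literature.AlgebraicGeometry.Motives.Grassmannian

open CategoryTheory Opposite TensorProduct _root_.AlgebraicGeometry

universe u

variable (M : Type u) [AddCommGroup M] (k : ℕ)

/-! ## §1 Values of a section at points -/

/-- **The value of a section of the Grassmannian sheaf at a point** `t ∈ T`: restrict `y ∈ Gr(T)` along
`Spec κ(t) → T` and read it in `G(k, κ(t) ⊗_ℤ M; κ(t))` through `specEquiv`.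
[cite: GortzWedhorn2020, (8.4) (pp. 213–215)] -/
noncomputable def ptEval {T : Scheme.{u}} (t : T) (y : (grassmannianSheaf M k).obj.obj (op T)) :
    Module.Grassmannian (T.residueField t) ((T.residueField t) ⊗[ℤ] M) k :=
  specEquiv M k (T.residueField t) ((grassmannianSheaf M k).obj.map (T.fromSpecResidueField t).op y)

/-- Definitional unfolding of `ptEval`. [cite: GortzWedhorn2020, (8.4) (pp. 213–215)] -/
theorem ptEval_def {T : Scheme.{u}} (t : T) (y : (grassmannianSheaf M k).obj.obj (op T)) :
    ptEval M k t y =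
      specEquiv M k (T.residueField t) ((grassmannianSheaf M k).obj.map (T.fromSpecResidueField t).op y) :=
  rfl

/-- **Naturality of point values**: for `h : T′ → T` and `t′ ∈ T′`, the value of `h^*y` at `t′` is the base change
along `κ(h t′) → κ(t′)` of the value of `y` at `h t′`. [cite: GortzWedhorn2020, (8.4) (pp. 213–215)] -/
theorem ptEval_map {T T' : Scheme.{u}} (h : T' ⟶ T) (y : (grassmannianSheaf M k).obj.obj (op T)) (t' : T') :
    ptEval M k t' ((grassmannianSheaf M k).obj.map h.op y) =
      Module.Grassmannian.map (h.residueFieldMap t').hom.toIntAlgHom (ptEval M k (h t') y) := by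
  rw [ptEval_def, ptEval_def, map_fromSpecResidueField_comp (F := (grassmannianSheaf M k).obj) y h t',
    specEquiv_naturality]

/-- Point values along a ring map `Spec L → Spec K`: the general naturality specialised.
[cite: GortzWedhorn2020, (8.4) (pp. 213–215)] -/
theorem ptEval_map_SpecMap {K L : CommRingCat.{u}} (φ : K ⟶ L)
    (y : (grassmannianSheaf M k).obj.obj (op (Spec K))) (q : Spec L) :
    ptEval M k q ((grassmannianSheaf M k).obj.map (Spec.map φ).op y) =
      Module.Grassmannian.map ((Spec.map φ).residueFieldMap q).hom.toIntAlgHom (ptEval M k (Spec.map φ q) y) :=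
  ptEval_map M k (Spec.map φ) y q

/-! ## §2 The chart subfunctor (pointwise definition) -/

variable (x : Fin k → M)

/-- **The chart subfunctor of the Grassmannian sheaf at the frame `x`**: sections all of whose point values lie in
the ring-side chart `chart ℤ M k x κ(t)` («the `x`-minor is invertible at every point»).  It is a subfunctor by
naturality of point values and base-change stability of the chart (B-p18 (C2) `map_mem_chart`).
[cite: GortzWedhorn2020, (8.4), Lemma 8.13 (p. 215)] [cite: StacksProject, Tag 089T] -/
noncomputable def chartSubsheaf : Subfunctor (grassmannianSheaf M k).obj where
  obj T := {y | ∀ t : (unop T : Scheme.{u}), ptEval M k t y ∈ chart ℤ M k x ((unop T).residueField t)}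
  map := by
    rintro ⟨T⟩ ⟨T'⟩ ⟨h⟩ y hy t'
    change ptEval M k t' ((grassmannianSheaf M k).obj.map h.op y) ∈ _
    rw [ptEval_map]
    exact map_mem_chart _ (hy (h t'))

/-- Membership in the chart subfunctor, unfolded. [cite: GortzWedhorn2020, (8.4), Lemma 8.13 (p. 215)] -/
theorem mem_chartSubsheaf_iff {T : Scheme.{u}} (y : (grassmannianSheaf M k).obj.obj (op T)) :
    y ∈ (chartSubsheaf M k x).obj (op T) ↔ ∀ t : T, ptEval M k t y ∈ chart ℤ M k x (T.residueField t) :=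
  Iff.rfl

/-- Over a field `K` (as an object of `CommRingCat` satisfying `IsField`), the prime spectrum is a single point.
[folklore] -/
private theorem primeSpectrum_subsingleton_of_isField {K : CommRingCat.{u}} (hK : IsField K) :
    Subsingleton (Spec K : Scheme.{u}) := by
  letI : Field K := hK.toField
  refine ⟨fun a b => PrimeSpectrum.ext ?_⟩
  rw [Ideal.eq_bot_of_prime a.asIdeal, Ideal.eq_bot_of_prime b.asIdeal]

/-- Field-extension invariance of chart membership (B-p18 `map_mem_chart_iff_of_field`, restated privately to
keep this file independent of `GrassmannianChartReflect`): over a field `K` the annihilator of the cokernel of the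
frame map is `⊥` or `⊤`. [folklore] -/
private theorem map_mem_chart_iff_of_field' {K : Type u} [Field K] {L : Type u} [CommRing L] [Nontrivial L]
    (f : K →ₐ[ℤ] L) (N : Module.Grassmannian K (K ⊗[ℤ] M) k) :
    Module.Grassmannian.map f N ∈ chart ℤ M k x L ↔ N ∈ chart ℤ M k x K := by
  rw [map_mem_chart_iff_map_annihilator_eq_top]
  have key : N ∈ chart ℤ M k x K ↔ Module.annihilator K
      (((K ⊗[ℤ] M) ⧸ N.toSubmodule) ⧸ LinearMap.range (frameMap x N.toSubmodule)) = ⊤ := by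
    rw [mem_chart_iff_surjective, ← LinearMap.range_eq_top, ← Submodule.Quotient.subsingleton_iff,
      Module.annihilator_eq_top_iff]
  rw [key]
  rcases Ideal.eq_bot_or_top (Module.annihilator K
      (((K ⊗[ℤ] M) ⧸ N.toSubmodule) ⧸ LinearMap.range (frameMap x N.toSubmodule))) with h | h
  · rw [h, Ideal.map_bot]
    simp only [bot_ne_top]
  · rw [h, Ideal.map_top]
    exact ⟨fun _ => rfl, fun _ => rfl⟩

/-- **The fibre condition**: the restriction of `y` to the point `t` lies in the chart subfunctor (over `Spec κ(t)`)
iff the value `ptEval t y` lies in the chart.  (Field-extension invariance of chart membership, B-p18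
`map_mem_chart_iff_of_field`, moves between `κ(t)` and the residue field of the point of `Spec κ(t)`.)
[cite: GortzWedhorn2020, (8.4), Lemma 8.13 (p. 215)] -/
theorem map_fromSpecResidueField_mem_chartSubsheaf_iff {T : Scheme.{u}}
    (y : (grassmannianSheaf M k).obj.obj (op T)) (t : T) :
    (grassmannianSheaf M k).obj.map (T.fromSpecResidueField t).op y ∈
        (chartSubsheaf M k x).obj (op (Spec (T.residueField t))) ↔
      ptEval M k t y ∈ chart ℤ M k x (T.residueField t) := by
  rw [mem_chartSubsheaf_iff]
  constructor
  · intro h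
    let q : Spec (T.residueField t) := ⟨⊥, Ideal.isPrime_bot⟩
    have hq := h q
    rw [ptEval_map] at hq
    have hq' := (map_mem_chart_iff_of_field' M k x _ _).mp hq
    have e : (T.fromSpecResidueField t) q = t := Scheme.fromSpecResidueField_apply t q
    rwa [e] at hq'
  · intro h q
    rw [ptEval_map]
    refine map_mem_chart _ ?_
    have e : (T.fromSpecResidueField t) q = t := Scheme.fromSpecResidueField_apply t q
    rw [e]
    exact h

/-- (pt) of `PointwiseOpenCondition` for the chart subfunctor: membership is tested on field-valued points.
[cite: GortzWedhorn2020, (8.4), Lemma 8.13 (p. 215)] -/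
theorem mem_chartSubsheaf_iff_pointwise {T : Scheme.{u}} (y : (grassmannianSheaf M k).obj.obj (op T)) :
    y ∈ (chartSubsheaf M k x).obj (op T) ↔
      ∀ t : T, (grassmannianSheaf M k).obj.map (T.fromSpecResidueField t).op y ∈
        (chartSubsheaf M k x).obj (op (Spec (T.residueField t))) := by
  simp only [map_fromSpecResidueField_mem_chartSubsheaf_iff]
  exact mem_chartSubsheaf_iff M k x y

/-- (refl) of `PointwiseOpenCondition` for the chart subfunctor: membership of a field-valued point is reflected
along field extensions `Spec L → Spec K`. [cite: GortzWedhorn2020, (8.4), Lemma 8.13 (p. 215)] -/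
theorem mem_chartSubsheaf_of_map_SpecMap_mem (K L : CommRingCat.{u}) (hK : IsField K) (hL : IsField L)
    (φ : K ⟶ L) (y : (grassmannianSheaf M k).obj.obj (op (Spec K)))
    (h : (grassmannianSheaf M k).obj.map (Spec.map φ).op y ∈ (chartSubsheaf M k x).obj (op (Spec L))) :
    y ∈ (chartSubsheaf M k x).obj (op (Spec K)) := by
  letI : Field L := hL.toField
  haveI := primeSpectrum_subsingleton_of_isField hK
  let q' : Spec L := ⟨⊥, Ideal.isPrime_bot⟩
  have hq := h q'
  rw [ptEval_map] at hq
  have hq' := (map_mem_chart_iff_of_field' M k x _ _).mp hq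
  intro q
  rwa [Subsingleton.elim q (Spec.map φ q')]

/-! ## §3 Point values on affine schemes; openness of the residue condition -/

/-- **The kernel of the evaluation `Γ(S, ⊤) → κ(q)` is the prime `S.toSpecΓ q`** (both are
`{r | q ∉ S.basicOpen r}`). [folklore] -/
private theorem mem_ker_Γevaluation_iff (S : Scheme.{u}) (q : S) (r : Γ(S, ⊤)) :
    r ∈ RingHom.ker (S.Γevaluation q).hom ↔ q ∉ S.basicOpen r := by
  rw [RingHom.mem_ker]
  exact S.evaluation_eq_zero_iff_notMem_basicOpen (U := ⊤) q trivial r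

/-- **The residue condition in terms of basic opens**: for any scheme `S`, `N ∈ G(k, Γ(S,⊤) ⊗ M)` and `q ∈ S`,
`N ⊗ κ(q) ∈ chart x` iff `q ∈ S.basicOpen a` for some `a` in the annihilator of `coker (frameMap x N)`
(B-p18 `map_mem_chart_iff_ker_notMem_support` + `Supp = V(Ann)`). [cite: StacksProject, Tag 089T] -/
theorem map_Γevaluation_mem_chart_iff (S : Scheme.{u})
    (N : Module.Grassmannian Γ(S, ⊤) (Γ(S, ⊤) ⊗[ℤ] M) k) (q : S) :
    Module.Grassmannian.map (S.Γevaluation q).hom.toIntAlgHom N ∈ chart ℤ M k x (S.residueField q) ↔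
      ∃ a ∈ Module.annihilator Γ(S, ⊤)
        (((Γ(S, ⊤) ⊗[ℤ] M) ⧸ N.toSubmodule) ⧸ LinearMap.range (frameMap x N.toSubmodule)),
        q ∈ S.basicOpen a := by
  rw [map_mem_chart_iff_ker_notMem_support, Module.mem_support_iff_of_finite, SetLike.not_le_iff_exists]
  refine exists_congr fun a => ?_
  rw [and_congr_right_iff]
  intro _
  change a ∉ RingHom.ker (S.Γevaluation q).hom ↔ _
  rw [mem_ker_Γevaluation_iff, not_not]

/-- **The residue condition is open** on any scheme `S`: `{q | N ⊗ κ(q) ∈ chart x}` is the union of the basic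
opens `S.basicOpen a`, `a ∈ Ann(coker frameMap x N)`. [cite: StacksProject, Tag 089T] -/
theorem isOpen_setOf_map_Γevaluation_mem_chart (S : Scheme.{u})
    (N : Module.Grassmannian Γ(S, ⊤) (Γ(S, ⊤) ⊗[ℤ] M) k) :
    IsOpen {q : S | Module.Grassmannian.map (S.Γevaluation q).hom.toIntAlgHom N ∈
      chart ℤ M k x (S.residueField q)} := by
  have hset : {q : S | Module.Grassmannian.map (S.Γevaluation q).hom.toIntAlgHom N ∈
      chart ℤ M k x (S.residueField q)} =
      ⋃ a ∈ Module.annihilator Γ(S, ⊤)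
        (((Γ(S, ⊤) ⊗[ℤ] M) ⧸ N.toSubmodule) ⧸ LinearMap.range (frameMap x N.toSubmodule)),
        (S.basicOpen a : Set S) := by
    ext q
    rw [Set.mem_setOf_eq, map_Γevaluation_mem_chart_iff]
    simp only [Set.mem_iUnion, SetLike.mem_coe, exists_prop]
  rw [hset]
  exact isOpen_biUnion fun a _ => (S.basicOpen a).isOpen

variable {M k} in
/-- **On an affine scheme, point values are residue images of `evalAffine ⊤`**: for `S` affine, `z ∈ Gr(S)` and
`q ∈ S`, `ptEval q z = (Γevaluation q)_* (evalAffine ⊤ z)`, because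
`fromSpecResidueField q = Spec (Γevaluation q) ≫ S.isoSpec.inv` (Mathlib `fromSpecStalk_toSpecΓ`).
[cite: GortzWedhorn2020, (8.4) (pp. 213–215)] -/
theorem ptEval_eq_map_evalAffine_top (S : Scheme.{u}) [IsAffine S]
    (z : (grassmannianSheaf M k).obj.obj (op S)) (q : S) :
    ptEval M k q z =
      Module.Grassmannian.map (S.Γevaluation q).hom.toIntAlgHom (evalAffine (isAffineOpen_top S) z) := by
  have hfac : S.fromSpecResidueField q = Spec.map (S.Γevaluation q) ≫ S.isoSpec.inv := by
    rw [← cancel_mono S.isoSpec.hom, Category.assoc, Iso.inv_hom_id, Category.comp_id, Scheme.isoSpec_hom,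
      Scheme.fromSpecResidueField, Category.assoc, Scheme.fromSpecStalk_toSpecΓ, ← Spec.map_comp]
    rfl
  rw [ptEval_def, hfac, op_comp, Functor.map_comp_apply, specEquiv_naturality, evalAffine_def,
    IsAffineOpen.fromSpec_top]

variable {M k} in
/-- On an affine scheme `S`, the locus `{q | ptEval q z ∈ chart x}` is open.
[cite: GortzWedhorn2020, (8.4), Lemma 8.13 (p. 215)] -/
theorem isOpen_setOf_ptEval_mem_chart_of_isAffine (S : Scheme.{u}) [IsAffine S]
    (z : (grassmannianSheaf M k).obj.obj (op S)) :
    IsOpen {q : S | ptEval M k q z ∈ chart ℤ M k x (S.residueField q)} := by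
  simp only [ptEval_eq_map_evalAffine_top]
  exact isOpen_setOf_map_Γevaluation_mem_chart M k x S _

/-! ## §4 The open locus of a section -/

variable {M k} in
/-- The pointwise locus `{t | (y restricted to t) ∈ chartSubsheaf}` of any section is open: local on `T`
(`isOpen_setOf_pointwise_of_openCover` with the affine cover) and open on affine schemes (§3).
[cite: GortzWedhorn2020, (8.4), Lemma 8.13 (p. 215)] -/
theorem isOpen_setOf_map_fromSpecResidueField_mem_chartSubsheaf {T : Scheme.{u}}
    (y : (grassmannianSheaf M k).obj.obj (op T)) :
    IsOpen {t : T | (grassmannianSheaf M k).obj.map (T.fromSpecResidueField t).op y ∈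
      (chartSubsheaf M k x).obj (op (Spec (T.residueField t)))} := by
  refine isOpen_setOf_pointwise_of_openCover (chartSubsheaf M k x) y T.affineCover fun i => ?_
  simp only [map_fromSpecResidueField_mem_chartSubsheaf_iff]
  exact isOpen_setOf_ptEval_mem_chart_of_isAffine x (T.affineCover.X i) _

variable {M k} in
/-- **The chart locus of a section** `y ∈ Gr(T)` at the frame `x`: the open subset of `T` of points at which the
value of `y` lies in the chart `chart ℤ M k x` («the `x`-minor of `y` is invertible at `t`»).
[cite: GortzWedhorn2020, (8.4), Lemma 8.13 (p. 215)] [cite: StacksProject, Tag 089T] -/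
noncomputable def chartLocus {T : Scheme.{u}} (y : (grassmannianSheaf M k).obj.obj (op T)) : T.Opens :=
  ⟨{t : T | (grassmannianSheaf M k).obj.map (T.fromSpecResidueField t).op y ∈
      (chartSubsheaf M k x).obj (op (Spec (T.residueField t)))},
    isOpen_setOf_map_fromSpecResidueField_mem_chartSubsheaf x y⟩

variable {M k} in
/-- Membership in the chart locus is the fibre condition (definitional).
[cite: GortzWedhorn2020, (8.4), Lemma 8.13 (p. 215)] -/
theorem mem_chartLocus_iff' {T : Scheme.{u}} (y : (grassmannianSheaf M k).obj.obj (op T)) (t : T) :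
    t ∈ chartLocus x y ↔ (grassmannianSheaf M k).obj.map (T.fromSpecResidueField t).op y ∈
      (chartSubsheaf M k x).obj (op (Spec (T.residueField t))) :=
  Iff.rfl

variable {M k} in
/-- **Membership in the chart locus**: `t ∈ chartLocus x y ↔ ptEval t y ∈ chart ℤ M k x κ(t)`.
[cite: GortzWedhorn2020, (8.4), Lemma 8.13 (p. 215)] -/
theorem mem_chartLocus_iff {T : Scheme.{u}} (y : (grassmannianSheaf M k).obj.obj (op T)) (t : T) :
    t ∈ chartLocus x y ↔ ptEval M k t y ∈ chart ℤ M k x (T.residueField t) := by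
  rw [mem_chartLocus_iff', map_fromSpecResidueField_mem_chartSubsheaf_iff]

variable {M k} in
/-- On an affine scheme the chart locus of `z` is read off `evalAffine ⊤ z`:
`q ∈ chartLocus x z ↔ (Γevaluation q)_*(evalAffine ⊤ z) ∈ chart`. [cite: GortzWedhorn2020, (8.4), Lemma 8.13 (p. 215)] -/
theorem mem_chartLocus_iff_of_isAffine (S : Scheme.{u}) [IsAffine S]
    (z : (grassmannianSheaf M k).obj.obj (op S)) (q : S) :
    q ∈ chartLocus x z ↔
      Module.Grassmannian.map (S.Γevaluation q).hom.toIntAlgHom (evalAffine (isAffineOpen_top S) z) ∈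
        chart ℤ M k x (S.residueField q) := by
  rw [mem_chartLocus_iff, ptEval_eq_map_evalAffine_top]

/-! ## §5 THE OPEN CONDITION and the sheaf property -/

variable {M k} in
/-- **THE OPEN CONDITION (A3.5)**: for `y ∈ Gr(T)` and `h : T′ → T`, the pullback `h^*y` lies in the chart
subfunctor over `T′` iff `h(T′) ⊆ chartLocus x y`.  This is the `hU` binder of
`isOpenImmersion_presheaf_of_openCondition` / `isRepresentable_of_openCondition_cover` for the chart at `x`
(via `openCondition_of_pointwise`; (pt) = `mem_chartSubsheaf_iff_pointwise`, (refl) =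
`mem_chartSubsheaf_of_map_SpecMap_mem`). [cite: GortzWedhorn2020, (8.4)–(8.4), Lemma 8.13 (p. 215)] -/
theorem map_mem_chartSubsheaf_iff {T T' : Scheme.{u}}
    (y : (grassmannianSheaf M k).obj.obj (op T)) (h : T' ⟶ T) :
    (grassmannianSheaf M k).obj.map h.op y ∈ (chartSubsheaf M k x).obj (op T') ↔
      Set.range h ⊆ (chartLocus x y : Set T) :=
  openCondition_of_pointwise (chartSubsheaf M k x) (fun y => mem_chartSubsheaf_iff_pointwise M k x y)
    (fun K L hK hL φ y hy => mem_chartSubsheaf_of_map_SpecMap_mem M k x K L hK hL φ y hy)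
    (fun y => chartLocus x y) (fun y t => mem_chartLocus_iff' x y t) y h

/-- **The chart subfunctor is a Zariski sheaf** (an open-condition subfunctor of the sheaf `grassmannianSheaf`;
`isSheaf_toFunctor_of_openCondition`). [cite: GortzWedhorn2020, (8.4) (pp. 213–215)] -/
theorem isSheaf_chartSubsheaf :
    Presheaf.IsSheaf Scheme.zariskiTopology (chartSubsheaf M k x).toFunctor :=
  isSheaf_toFunctor_of_openCondition (grassmannianSheaf M k).property (chartSubsheaf M k x)
    (fun y => chartLocus x y) (fun y h => map_mem_chartSubsheaf_iff x y h)

/-! ## §6 Affine description of the chart subfunctor -/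

/-- For `S` affine, every prime of `Γ(S, ⊤)` is the kernel prime of the evaluation at some point of `S`
(`S.isoSpec` is a bijection on points and `ker (Γevaluation q) = S.toSpecΓ q`). [folklore] -/
private theorem exists_toSpecΓ_eq (S : Scheme.{u}) [IsAffine S] (p : Spec Γ(S, ⊤)) :
    ∃ q : S, S.toSpecΓ q = p :=
  ⟨S.isoSpec.inv p, by
    have h := (Scheme.Hom.comp_apply S.isoSpec.inv S.toSpecΓ p).symm
    rwa [Scheme.isoSpec_inv_toSpecΓ] at h⟩

/-- The kernel prime of `Γevaluation q` (as a `ℤ`-algebra map) is the point `S.toSpecΓ q` of `Spec Γ(S, ⊤)`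
(both are `{r | q ∉ S.basicOpen r}`). [folklore] -/
private theorem ker_Γevaluation_eq_toSpecΓ (S : Scheme.{u}) (q : S) :
    (⟨RingHom.ker ((S.Γevaluation q).hom.toIntAlgHom : Γ(S, ⊤) →+* S.residueField q), RingHom.ker_isPrime _⟩ :
        PrimeSpectrum Γ(S, ⊤)) = S.toSpecΓ q := by
  refine PrimeSpectrum.ext (Ideal.ext fun r => ?_)
  change r ∈ RingHom.ker (S.Γevaluation q).hom ↔ r ∈ (S.toSpecΓ q).asIdeal
  rw [mem_ker_Γevaluation_iff, ← not_iff_not, not_not]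
  have h := congrArg (fun U : S.Opens => q ∈ U) (S.toSpecΓ_preimage_basicOpen r)
  simp only [eq_iff_iff] at h
  rw [← h]
  exact PrimeSpectrum.mem_basicOpen _ _

variable {M k} in
/-- **Affine description of the chart subfunctor**: on an affine scheme `S`, `z ∈ chartSubsheaf(S)` iff
`evalAffine ⊤ z ∈ chart ℤ M k x Γ(S, ⊤)` — chart membership over a ring is tested at all residue fields
(B-p18 C3-inst: `N ∈ chart ↔ coker (frameMap x N) = 0 ↔ Supp = ∅`).  With (C4) this makes
`yoneda (chart scheme) → chartSubsheaf` bijective on affine schemes. [cite: GortzWedhorn2020, (8.4), Lemma 8.13 (p. 215)]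
[cite: StacksProject, Tag 089T] -/
theorem mem_chartSubsheaf_iff_evalAffine_top (S : Scheme.{u}) [IsAffine S]
    (z : (grassmannianSheaf M k).obj.obj (op S)) :
    z ∈ (chartSubsheaf M k x).obj (op S) ↔ evalAffine (isAffineOpen_top S) z ∈ chart ℤ M k x Γ(S, ⊤) := by
  rw [mem_chartSubsheaf_iff]
  simp only [ptEval_eq_map_evalAffine_top, map_mem_chart_iff_ker_notMem_support, ker_Γevaluation_eq_toSpecΓ]
  rw [mem_chart_iff_surjective, ← LinearMap.range_eq_top, ← Submodule.Quotient.subsingleton_iff,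
    ← Module.support_eq_empty_iff (R := Γ(S, ⊤)), Set.eq_empty_iff_forall_notMem]
  constructor
  · intro h p
    obtain ⟨q, rfl⟩ := exists_toSpecΓ_eq S p
    exact h q
  · intro h q
    exact h _

/-! ## §7 Affine descriptions consumed by (A3.3)/(A3.6)/(A4) -/

/-- Chart membership is invariant under ring isomorphisms (transport with `Module.Grassmannian.map_comp` /
`map_id`). [folklore] -/
private theorem map_mem_chart_iff_of_iso {A B : CommRingCat.{u}} (e : A ≅ B)
    (N : Module.Grassmannian A (A ⊗[ℤ] M) k) :
    Module.Grassmannian.map e.hom.hom.toIntAlgHom N ∈ chart ℤ M k x B ↔ N ∈ chart ℤ M k x A := by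
  refine ⟨fun h => ?_, fun h => map_mem_chart _ h⟩
  have h2 := map_mem_chart e.inv.hom.toIntAlgHom h
  rw [← Module.Grassmannian.map_comp] at h2
  have hid : e.inv.hom.toIntAlgHom.comp e.hom.hom.toIntAlgHom = AlgHom.id ℤ A := by
    refine AlgHom.ext fun a => ?_
    change (e.hom ≫ e.inv).hom a = a
    rw [e.hom_inv_id]
    rfl
  rw [hid] at h2
  have h3 := Module.Grassmannian.map_id (R := ℤ) (M := M) k (CommAlgCat.of ℤ A) N
  exact h3 ▸ h2

variable {M k} in
/-- **Membership in the chart subfunctor over `Spec A`** is chart membership of `specEquiv A y` (the (D3)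
comparison `Gr(Spec A) ≃ G(k, A ⊗ M)`): from `mem_chartSubsheaf_iff_evalAffine_top` and `evalAffine_top`
(`Γ(Spec A, ⊤) ≅ A`). [cite: GortzWedhorn2020, (8.4), Lemma 8.13 (p. 215)] -/
theorem mem_chartSubsheaf_Spec_iff (A : CommRingCat.{u}) (y : (grassmannianSheaf M k).obj.obj (op (Spec A))) :
    y ∈ (chartSubsheaf M k x).obj (op (Spec A)) ↔ specEquiv M k A y ∈ chart ℤ M k x A := by
  rw [mem_chartSubsheaf_iff_evalAffine_top, evalAffine_top]
  exact map_mem_chart_iff_of_iso M k x (Scheme.ΓSpecIso A).symm (specEquiv M k A y)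

variable {M k} in
/-- **Affine-local description of the chart subfunctor** (the form of the interface memo): `y ∈ chartSubsheaf(T)`
iff for every affine open `V ⊆ T` the evaluation `evalAffine V y ∈ G(k, Γ(T,V) ⊗ M)` lies in the chart.
(→: restrict along `hV.fromSpec` and use `mem_chartSubsheaf_Spec_iff`; ←: every point has an affine
neighbourhood `V`, `hV.fromSpec` is onto `V`, and chart membership is reflected along `κ(t) → κ(q)`.)
[cite: GortzWedhorn2020, (8.4), Lemma 8.13 (p. 215)] -/
theorem mem_chartSubsheaf_iff_evalAffine {T : Scheme.{u}} (y : (grassmannianSheaf M k).obj.obj (op T)) :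
    y ∈ (chartSubsheaf M k x).obj (op T) ↔
      ∀ (V : T.Opens) (hV : IsAffineOpen V), evalAffine hV y ∈ chart ℤ M k x Γ(T, V) := by
  constructor
  · intro hy V hV
    have hw : (grassmannianSheaf M k).obj.map hV.fromSpec.op y ∈
        (chartSubsheaf M k x).obj (op (Spec Γ(T, V))) := (chartSubsheaf M k x).map hV.fromSpec.op hy
    rw [mem_chartSubsheaf_Spec_iff] at hw
    rwa [evalAffine_def]
  · intro h t
    obtain ⟨V, hV, htV, -⟩ := exists_isAffineOpen_mem_and_subset (U := ⊤) (x := t) trivial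
    have hw : (grassmannianSheaf M k).obj.map hV.fromSpec.op y ∈
        (chartSubsheaf M k x).obj (op (Spec Γ(T, V))) := by
      rw [mem_chartSubsheaf_Spec_iff, ← evalAffine_def]
      exact h V hV
    obtain ⟨q, hq⟩ : t ∈ Set.range hV.fromSpec := by rw [IsAffineOpen.range_fromSpec]; exact htV
    have hq' := hw q
    rw [ptEval_map] at hq'
    have hq'' := (map_mem_chart_iff_of_field' M k x _ _).mp hq'
    rwa [hq] at hq''

/-! ## §8 Field-valued points are covered by the charts of a generating family -/

/-- **Every field-valued point lies in some chart** ((A3.6) input in `chartSubsheaf` form): for a family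
`g : J → M` generating `M` and `y ∈ Gr(Spec K)`, `K` a field, some injective `I : Fin k → J` has
`y ∈ chartSubsheaf (g ∘ I) (Spec K)` (B-p18 (C5) `exists_mem_chart_of_field` for `specEquiv K y`, transported along
`K ≅ Γ(Spec K, ⊤)`). This is the `hcover` binder of `isRepresentable_of_openCondition_cover` up to the identification
(A3.5)(c) of `chartSubsheaf` with the image of the chart map. [cite: GortzWedhorn2020, (8.4), Lemma 8.13 (p. 215)]
[cite: StacksProject, Tag 089T] -/
theorem exists_mem_chartSubsheaf_of_field {J : Type*} (g : J → M) (hg : Submodule.span ℤ (Set.range g) = ⊤)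
    (K : Type u) [Field K] (y : (grassmannianSheaf M k).obj.obj (op (Spec (CommRingCat.of K)))) :
    ∃ I : Fin k → J, Function.Injective I ∧
      y ∈ (chartSubsheaf M k (g ∘ I)).obj (op (Spec (CommRingCat.of K))) := by
  obtain ⟨I, hI, hN⟩ := exists_mem_chart_of_field (R := ℤ) g hg (specEquiv M k (CommRingCat.of K) y)
  refine ⟨I, hI, ?_⟩
  rw [mem_chartSubsheaf_iff_evalAffine_top, evalAffine_top]
  exact map_mem_chart _ hN

end Literature.AlgebraicGeometry.Motives.Grassmannian
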